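import Summits.ABC.ABC.Theorems.SoloBlindOddCofactor

/-!
# Coprime exponents on the generic `ω = 3` equations (solo-blind seat, session 7; part 2 of 2)

For the two generic three-prime-power equations of the first open support `{2, p, q}`,

* shape A: `2^l + q^m = rⁿ`, and
* shape B: `p^l + q^m = 2ⁿ`

(`p, q, r` odd, `> 1`), the parity of the cyclotomic cofactor (`SoloBlindOddCofactor`) gives, with no
transcendence and no modularity input:

* `shapeB_coprime_exponents` : `p^l + q^m = 2ⁿ` (`p, q` odd, `1 < p`, `0 < l`) ⇒ `Nat.Coprime l m`;
* `shapeA_coprime_exponents` : `2^l + q^m = rⁿ`, `0 < m`, `0 < n` ⇒ `Nat.Coprime m n`, or `m = 2` and either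
  `n = 2 ∧ r = 2^(l-2) + 1 ∧ q = 2^(l-2) - 1` or `(n, r, q, l) = (4, 3, 7, 5)` (`32 + 49 = 81`);
* `shapeA_coprime_exponents_prime` : for odd primes `q, r` the exceptional set is exactly
  `(l, q, m, r, n) ∈ {(4, 3, 2, 5, 2), (5, 7, 2, 3, 4)}`;
* `shapeA_equal_exponent_uncond`, `shapeB_equal_exponent_uncond` : in particular the equal-exponent slices
  `2^l + q^m = r^m` (`m ≥ 3`) and `p^m + q^m = 2ⁿ` (`m ≥ 2`) are empty UNCONDITIONALLY — the session-5 versions of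
  these two statements (`SoloBlindEqualExponents`) carried Wiles, Ribet 1997 and Darmon–Merel 1997 as hypotheses for
  exponents with a prime factor `≥ 5`; those hypotheses are unnecessary.

All proofs are elementary (Mathlib only). [folklore]
-/

namespace Summit.ABC.ABC.Theorems

/-! ### Shape B: `p^l + q^m = 2ⁿ` -/

/-- **Shape B has coprime exponents.** `p, q` odd, `1 < p`, `0 < l`, `p^l + q^m = 2ⁿ` ⇒ `gcd(l, m) = 1`
(by symmetry the same holds with the roles of `(p, l)` and `(q, m)` exchanged).
(Elementary: with `g = gcd`, `X = p^(l/g)`, `Y = q^(m/g)` one has `X^g + Y^g = 2ⁿ`; `g` even is impossible mod `4`,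
`g` odd forces `g = 1` because the cofactor of `X + Y` is odd.) -/
theorem shapeB_coprime_exponents {p q l m n : ℕ} (hp : Odd p) (hq : Odd q) (hp1 : 1 < p)
    (hl : 0 < l) (h : p ^ l + q ^ m = 2 ^ n) : Nat.Coprime l m := by
  set g := Nat.gcd l m with hg
  have hg0 : g ≠ 0 := by rw [hg]; exact Nat.gcd_ne_zero_left (by omega)
  have hlg : g ∣ l := Nat.gcd_dvd_left l m
  have hmg : g ∣ m := Nat.gcd_dvd_right l m
  set X := p ^ (l / g) with hX
  set Y := q ^ (m / g) with hY
  have hXg : X ^ g = p ^ l := by rw [hX, ← pow_mul, Nat.div_mul_cancel hlg]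
  have hYg : Y ^ g = q ^ m := by rw [hY, ← pow_mul, Nat.div_mul_cancel hmg]
  have hXodd : Odd X := hX ▸ hp.pow
  have hYodd : Odd Y := hY ▸ hq.pow
  have hX1 : 1 < X := by
    rw [hX]
    have : 1 ≤ l / g := Nat.div_pos (Nat.le_of_dvd hl hlg) (Nat.pos_of_ne_zero hg0)
    calc 1 < p := hp1
      _ = p ^ 1 := (pow_one p).symm
      _ ≤ p ^ (l / g) := Nat.pow_le_pow_right (by omega) this
  have h' : X ^ g + Y ^ g = 2 ^ n := by rw [hXg, hYg, h]
  rcases Nat.even_or_odd g with hev | hod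
  · exact (odd_pow_add_pow_ne_two_pow hXodd hYodd hX1 hev hg0 h').elim
  · have : g = 1 := odd_pow_add_pow_eq_two_pow hXodd hYodd hX1 hod h'
    exact this

/-- **Shape B, equal exponents — unconditional.** `p, q` odd, `> 1`, `m ≥ 2`: `p^m + q^m ≠ 2ⁿ`.
(Session 5's `shapeB_equal_exponent` assumed Wiles, Ribet 1997 and Darmon–Merel 1997 for this.) -/
theorem shapeB_equal_exponent_uncond {p q m n : ℕ} (hp : Odd p) (hq : Odd q) (hp1 : 1 < p)
    (hm : 2 ≤ m) (h : p ^ m + q ^ m = 2 ^ n) : False := by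
  have := shapeB_coprime_exponents hp hq hp1 (by omega) h
  rw [Nat.coprime_self] at this
  omega

/-! ### Shape A: `2^l + q^m = rⁿ` -/

/-- **Shape A has coprime odd-base exponents, up to two sporadic families.** `q, r` odd and `> 1`, `0 < m`, `0 < n`,
`2^l + q^m = rⁿ` ⇒ `gcd(m, n) = 1`, or `m = 2` and (`n = 2`, `r = 2^(l-2) + 1`, `q = 2^(l-2) - 1`) or
(`n = 4`, `r = 3`, `q = 7`, `l = 5`). -/
theorem shapeA_coprime_exponents {q r l m n : ℕ} (hq : Odd q) (hr : Odd r) (hq1 : 1 < q) (hr1 : 1 < r)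
    (hm : 0 < m) (hn : 0 < n) (h : 2 ^ l + q ^ m = r ^ n) :
    Nat.Coprime m n ∨
      (m = 2 ∧ ((n = 2 ∧ r = 2 ^ (l - 2) + 1 ∧ q = 2 ^ (l - 2) - 1) ∨ (n = 4 ∧ r = 3 ∧ q = 7 ∧ l = 5))) := by
  set g := Nat.gcd m n with hg
  have hg0 : g ≠ 0 := by rw [hg]; exact Nat.gcd_ne_zero_left (by omega)
  have hmg : g ∣ m := Nat.gcd_dvd_left m n
  have hng : g ∣ n := Nat.gcd_dvd_right m n
  set X := r ^ (n / g) with hX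
  set Y := q ^ (m / g) with hY
  have hXg : X ^ g = r ^ n := by rw [hX, ← pow_mul, Nat.div_mul_cancel hng]
  have hYg : Y ^ g = q ^ m := by rw [hY, ← pow_mul, Nat.div_mul_cancel hmg]
  have hXodd : Odd X := hX ▸ hr.pow
  have hYodd : Odd Y := hY ▸ hq.pow
  have hng1 : 1 ≤ n / g := Nat.div_pos (Nat.le_of_dvd hn hng) (Nat.pos_of_ne_zero hg0)
  have hmg1 : 1 ≤ m / g := Nat.div_pos (Nat.le_of_dvd hm hmg) (Nat.pos_of_ne_zero hg0)
  have hX1 : 1 < X := by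
    rw [hX]
    calc 1 < r := hr1
      _ = r ^ 1 := (pow_one r).symm
      _ ≤ r ^ (n / g) := Nat.pow_le_pow_right (by omega) hng1
  have hY1 : 1 < Y := by
    rw [hY]
    calc 1 < q := hq1
      _ = q ^ 1 := (pow_one q).symm
      _ ≤ q ^ (m / g) := Nat.pow_le_pow_right (by omega) hmg1
  have h2l : 1 ≤ 2 ^ l := Nat.one_le_two_pow
  have h' : X ^ g - Y ^ g = 2 ^ l := by rw [hXg, hYg]; omega
  have hYX : Y < X := by
    by_contra hle
    have : X ^ g ≤ Y ^ g := Nat.pow_le_pow_left (Nat.le_of_not_lt hle) g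
    rw [hXg, hYg] at this; omega
  rcases Nat.even_or_odd g with hev | hod
  · -- `g = 2k`: `(X^k - Y^k)(X^k + Y^k) = 2^l`
    obtain ⟨k, hk⟩ := hev
    have hk0 : k ≠ 0 := by omega
    set U := X ^ k with hU
    set V := Y ^ k with hV
    have hUodd : Odd U := hU ▸ hXodd.pow
    have hVodd : Odd V := hV ▸ hYodd.pow
    have hVU : V < U := by rw [hU, hV]; exact Nat.pow_lt_pow_left hYX hk0
    have hV1 : 1 < V := by
      rw [hV]
      calc 1 < Y := hY1
        _ = Y ^ 1 := (pow_one Y).symm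
        _ ≤ Y ^ k := Nat.pow_le_pow_right (by omega) (Nat.pos_of_ne_zero hk0)
    have hXU : X ^ g = U * U := by rw [hU, ← pow_add, hk]
    have hYV : Y ^ g = V * V := by rw [hV, ← pow_add, hk]
    have hprod : (U - V) * (U + V) = 2 ^ l := by
      rw [← h', hXU, hYV, Nat.mul_comm (U - V), ← Nat.sq_sub_sq, pow_two, pow_two]
    have hdp : U + V ∣ 2 ^ l := ⟨U - V, by rw [mul_comm]; exact hprod.symm⟩
    obtain ⟨j, -, hj⟩ := (Nat.dvd_prime_pow Nat.prime_two).mp hdp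
    -- `U + V = X^k + Y^k = 2^j` forces `k = 1`
    have hk1 : k = 1 := by
      have hsum : X ^ k + Y ^ k = 2 ^ j := by rw [← hU, ← hV, hj]
      rcases Nat.even_or_odd k with hkev | hkod
      · exact (odd_pow_add_pow_ne_two_pow hXodd hYodd hX1 hkev hk0 hsum).elim
      · exact odd_pow_add_pow_eq_two_pow hXodd hYodd hX1 hkod hsum
    subst hk1
    have hg2 : g = 2 := by omega
    -- now `U = X`, `V = Y`, `(X - Y)(X + Y) = 2^l`, `X - Y = 2^i`, `X + Y = 2^j` with `i = 1`
    have hdm : U - V ∣ 2 ^ l := ⟨U + V, hprod.symm⟩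
    obtain ⟨i, -, hi⟩ := (Nat.dvd_prime_pow Nat.prime_two).mp hdm
    have hi1 : i = 1 := by
      obtain ⟨u, hu⟩ := hUodd
      obtain ⟨v, hv⟩ := hVodd
      rcases i with _ | _ | i
      · exfalso; simp at hi; omega
      · rfl
      · exfalso
        -- `4 ∣ U - V` and `U + V = 2^j` with `j ≥ 2` ⇒ `4 ∣ 2V`, contradiction
        have h4m : 4 ∣ U - V := by rw [hi]; exact ⟨2 ^ i, by ring⟩
        have hj2 : 2 ≤ j := by
          by_contra hj2
          interval_cases j <;> simp at hj <;> omega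
        have h4p : 4 ∣ U + V := by
          rw [hj]; obtain ⟨t, ht⟩ : ∃ t, j = t + 2 := ⟨j - 2, by omega⟩
          rw [ht]; exact ⟨2 ^ t, by ring⟩
        omega
    subst hi1
    have hl2 : l = j + 1 := by
      have : 2 ^ l = 2 ^ 1 * 2 ^ j := by rw [← hi, ← hj, hprod]
      rw [← pow_add] at this
      have := Nat.pow_right_injective (le_refl 2) this
      omega
    have hj1 : 1 ≤ j := by
      by_contra hj0
      have : j = 0 := by omega
      subst this; simp at hj; omega
    obtain ⟨t, ht⟩ : ∃ t, j = t + 1 := ⟨j - 1, by omega⟩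
    have h2t : 2 ^ j = 2 * 2 ^ t := by rw [ht, pow_succ, mul_comm]
    have hlt : l - 2 = t := by omega
    simp only [pow_one] at hi
    have hVeq : V = 2 ^ (l - 2) - 1 := by rw [hlt]; omega
    have hUeq : U = 2 ^ (l - 2) + 1 := by rw [hlt]; omega
    -- `V = Y = q^(m/2) = 2^(l-2) - 1`: a perfect power only trivially
    have hm2 : m / g = 1 := by
      by_contra hne
      have h2 : 2 ≤ m / g := by omega
      have hl3 : 1 ≤ l - 2 := by
        by_contra hl
        have : l - 2 = 0 := by omega
        rw [this] at hVeq; simp at hVeq; omega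
      refine two_pow_sub_one_ne_pow hl3 hq1 h2 ?_
      rw [← hVeq, hV, pow_one, hY]
    have hmeq : m = 2 := by
      have := Nat.div_mul_cancel hmg
      rw [hm2, hg2] at this; omega
    have hqeq : q = 2 ^ (l - 2) - 1 := by
      have : Y = q := by rw [hY, hm2, pow_one]
      rw [← this, ← hVeq, hV, pow_one]
    -- `U = X = r^(n/2) = 2^(l-2) + 1`
    rcases Nat.lt_or_ge (n / g) 2 with hn1 | hn2
    · have hn2' : n / g = 1 := by omega
      have hneq : n = 2 := by
        have := Nat.div_mul_cancel hng
        rw [hn2', hg2] at this; omega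
      have hreq : r = 2 ^ (l - 2) + 1 := by
        have : X = r := by rw [hX, hn2', pow_one]
        rw [← this, ← hUeq, hU, pow_one]
      exact Or.inr ⟨hmeq, Or.inl ⟨hneq, hreq, hqeq⟩⟩
    · have hpow : 2 ^ (l - 2) + 1 = r ^ (n / g) := by rw [← hX, ← hUeq, hU, pow_one]
      obtain ⟨hl5, hr3, hng2⟩ := two_pow_add_one_eq_pow hn2 hpow
      have hneq : n = 4 := by
        have := Nat.div_mul_cancel hng
        rw [hng2, hg2] at this; omega
      have hl : l = 5 := by omega
      refine Or.inr ⟨hmeq, Or.inr ⟨hneq, hr3, ?_, hl⟩⟩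
      rw [hqeq, hl]; norm_num
  · -- `g` odd ⇒ `g = 1`
    have : g = 1 := odd_pow_sub_pow_eq_two_pow hXodd hYodd hYX hod h'
    exact Or.inl this

/-- **Shape A, equal exponents — unconditional.** `q, r` odd, `> 1`, `m ≥ 3`: `2^l + q^m ≠ r^m`.
(Session 5's `shapeA_equal_exponent` assumed Wiles, Ribet 1997 and Darmon–Merel 1997 for this.) -/
theorem shapeA_equal_exponent_uncond {q r l m : ℕ} (hq : Odd q) (hr : Odd r) (hq1 : 1 < q) (hr1 : 1 < r)
    (hm : 3 ≤ m) (h : 2 ^ l + q ^ m = r ^ m) : False := by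
  rcases shapeA_coprime_exponents hq hr hq1 hr1 (by omega) (by omega) h with hc | ⟨hm2, _⟩
  · rw [Nat.coprime_self] at hc; omega
  · omega

/-- **Shape A with prime bases.** For odd primes `q, r`: `2^l + q^m = rⁿ` (`0 < m`, `0 < n`) ⇒ `gcd(m, n) = 1`
unless `(l, q, m, r, n) = (4, 3, 2, 5, 2)` (`16 + 9 = 25`) or `(5, 7, 2, 3, 4)` (`32 + 49 = 81`). -/
theorem shapeA_coprime_exponents_prime {q r l m n : ℕ} (hq : q.Prime) (hr : r.Prime) (hq2 : q ≠ 2) (hr2 : r ≠ 2)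
    (hm : 0 < m) (hn : 0 < n) (h : 2 ^ l + q ^ m = r ^ n) :
    Nat.Coprime m n ∨ (l = 4 ∧ q = 3 ∧ m = 2 ∧ r = 5 ∧ n = 2) ∨ (l = 5 ∧ q = 7 ∧ m = 2 ∧ r = 3 ∧ n = 4) := by
  have hqodd : Odd q := hq.odd_of_ne_two hq2
  have hrodd : Odd r := hr.odd_of_ne_two hr2
  rcases shapeA_coprime_exponents hqodd hrodd hq.one_lt hr.one_lt hm hn h with hc | ⟨hm2, hcase⟩
  · exact Or.inl hc
  · rcases hcase with ⟨hn2, hreq, hqeq⟩ | ⟨hn4, hr3, hq7, hl5⟩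
    · -- `q = 2^a - 1` and `r = 2^a + 1` both prime (`a = l - 2`) ⇒ `a = 2`
      right; left
      set a := l - 2 with ha
      have ha1 : 2 ≤ a := by
        by_contra hlt
        interval_cases a
        · simp at hqeq; rw [hqeq] at hq; exact Nat.not_prime_zero hq
        · simp at hqeq; rw [hqeq] at hq; exact Nat.not_prime_one hq
      -- `a` even: otherwise `3 ∣ 2^a + 1 = r`, so `r = 3`, `2^a = 2`, `a = 1`
      have haev : Even a := by
        by_contra hodd
        rw [Nat.not_even_iff_odd] at hodd
        have h3 : 3 ∣ 2 ^ a + 1 := by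
          obtain ⟨t, ht⟩ := hodd
          rw [Nat.dvd_iff_mod_eq_zero, Nat.add_mod, ht, pow_succ, pow_mul, Nat.mul_mod, Nat.pow_mod]
          norm_num
        rw [← hreq] at h3
        have : r = 3 := ((Nat.prime_dvd_prime_iff_eq Nat.prime_three hr).mp h3).symm
        rw [this] at hreq
        have h2a : 2 ^ a = 2 := by omega
        have : a = 1 := by
          have := Nat.pow_right_injective (le_refl 2) (h2a.trans (pow_one 2).symm)
          exact this
        omega
      obtain ⟨b, hb⟩ := haev
      have hb1 : 1 ≤ b := by omega
      -- `2^(2b) - 1 = (2^b - 1)(2^b + 1)` prime ⇒ `2^b - 1 = 1`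
      have hfac : q = (2 ^ b - 1) * (2 ^ b + 1) := by
        rw [hqeq, hb, mul_comm (2 ^ b - 1), ← Nat.sq_sub_sq, one_pow, ← pow_mul]
        congr 1; ring_nf
      have hunit := (Nat.prime_mul_iff.mp (hfac ▸ hq))
      have hb1' : 2 ^ b - 1 = 1 := by
        rcases hunit with ⟨_, h1⟩ | ⟨_, h1⟩
        · exfalso; have : 1 ≤ 2 ^ b := Nat.one_le_two_pow; omega
        · exact h1
      have hb2 : 2 ^ b = 2 := by have : 1 ≤ 2 ^ b := Nat.one_le_two_pow; omega
      have hbeq : b = 1 := Nat.pow_right_injective (le_refl 2) (hb2.trans (pow_one 2).symm)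
      have haeq : a = 2 := by omega
      have hl4 : l = 4 := by omega
      rw [haeq] at hqeq hreq
      norm_num at hqeq hreq
      exact ⟨hl4, hqeq, hm2, hreq, hn2⟩
    · right; right
      exact ⟨hl5, hq7, hm2, hr3, hn4⟩

end Summit.ABC.ABC.Theorems
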